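import Summits.RiemannHypothesis.RiemannHypothesis.Theorems.Splittings.JensenMixedSplitWitness
import Literature.Analysis.Complex.JensenPolynomialSector
import Literature.NumberTheory.LFunctions.XiTaylor
import HarnessLib

/-!
# Splittings / Jensen — the mixed-split witness, part 2/3: Jensen-row bookkeeping and the packaged witness
# (given the analytic input «every zero of `F'` is real»), plus Fw-free trigonometric lemmas for part 3

Cell rh-split, seat rh-split-jen-bridge (gen 2 §§3–4, gen 3 §5 helper identities); scratch
`HOME/rh-split-jen-bridge/SketchG3.lean`; filed zero-def by rh-split-typer-1 g3 (G1, option C).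

Zero-definition raw form (cell convention): the seat's `Fw c ε` is SPELLED OUT everywhere as the lambda
`fun w : ℂ ↦ ((w + c) ^ 2 + (ε : ℂ) ^ 2) * coshSqrt w` (`coshSqrt` = the tree's `cosh √·`,
`Literature.Barriers.RiemannHypothesis.JensenPolynomialsSqrt`), its values beta-reduced
(`((w + c)² + ε²)·cosh √w`), the planted pair `w± = -c ± iε` as `-(c : ℂ) ± ε * I`, the sea zeros
`s_j = -((2j+1)π/2)²` literally, and the seat's Props `DerivZerosReal c ε` («every zero of `F'_{c,ε}` is
real») / `MixedSplitWitness C D F` as the written-out `∀` / conjunction.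

Contents:
* §3 rows `n ≥ 1` of the Jensen grid of `F_{c,ε}` are hyperbolic GIVEN «zeros of `F'` real»
  (`splits_jensenPoly_Fw_of_derivZerosReal`: shift = differentiation + the tree's genus-zero Laguerre–Pólya ⟹
  Jensen theorem); row `0` is hyperbolic in degrees `d·ε² ≤ c² + ε²` (`splits_jensenPoly_Fw_zero_of_le`, the
  tree's Kim–Lee / Obreschkoff sector theorem); a general Pólya–Schur converse in `taylorCoeffSeq` vocabulary
  (`im_eq_zero_of_forall_splits_taylorCoeffSeq`, any real entire `F`), whence some row-`0` polynomial of
  `F_{c,ε}` is NOT hyperbolic (`exists_not_splits_jensenPoly_Fw_zero`, `not_allHyperbolic_Fw`) and the non-real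
  zero set is finite (`finite_nonreal_zeros_Fw`).
* §4 the typed no-go shape, written out: for `c = (kπ)²`, `k ≥ 1`, `0 < ε`, `D ε² ≤ c² + ε²`, and GIVEN the
  analytic input, `F_{c,ε}` is real entire of order `< 1`, `F 0 ≠ 0`, its zeros of modulus `≤ c` are real
  (non-vacuously), every `J^{d,n}` with `n ≥ 1` or `d ≤ D` is hyperbolic, finitely many non-real zeros,
  `EventuallyHyperbolic`, and yet `¬ AllHyperbolic` (`mixedSplitWitness_Fw`, `exists_mixedSplitWitness`).
* §5a six `F`-free identities/inequalities used by part 3 (`sinh_mul_conj_cosh`, `im_sinh_mul_conj_cosh_mul_conj`,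
  `mul_sin_lt_sq`, `sq_lt_mul_sinh`, `mul_mul_sub_neg`, `im_mul_conj_sq_add`).

HONEST LABEL: «SPLITTING SEARCH over kernel-typed RH-EQUIVALENCES; a splitting A ∧ B ⟹ RH is
CONDITIONAL bookkeeping unless A and B are both proved; nothing here bears on the truth of RH.»
-/

noncomputable section

set_option linter.dupNamespace false

open Complex Polynomial Filter Topology
open scoped Nat Real ComplexConjugate

namespace Summit.RiemannHypothesis.RiemannHypothesis.Theorems.Splittings.JensenMixedSplit

open Literature.Barriers.RiemannHypothesis
open Literature.NumberTheory.LFunctions (jensenPoly exists_sq_eq iteratedDeriv_conj_of_conj)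
open Literature.Analysis.TotalPositivity (IsEntireOfOrderLtOne)
open Literature.Analysis.Complex.Obreschkoff (sector mem_sector splits_jensenPoly_taylor_of_zeros_mem_sector)

/-! ## §3 Hyperbolicity bookkeeping -/


/-- Rows `n ≥ 1`: `J^{d,n}(F) = J^{d,n-1}(F')` (shift = differentiation). [folklore] -/
theorem jensenPoly_taylorCoeffSeq_succ (F : ℂ → ℂ) (d m : ℕ) :
    jensenPoly (taylorCoeffSeq F) d (m + 1) =
      jensenPoly (fun k ↦ (iteratedDeriv k (deriv F) 0).re) d m := by
  ext j
  simp only [coeff_jensenPoly, taylorCoeffSeq]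
  rw [← iteratedDeriv_succ', show m + 1 + j = m + j + 1 by ring]

/-- **RowBlock 1 (the `RH_m`-analogue for every `m ≥ 1`).** If every zero of `F'` is real then every
`J^{d,n}(F)` with `n ≥ 1` is hyperbolic (the tree's genus-zero Laguerre–Pólya ⟹ Jensen theorem applied
to `F'`, which is entire of order `< 1` with `F'(0) = 2c + (c²+ε²)/2 ≠ 0`).
[cite: CravenCsordas1989, §1 (i)] -/
theorem splits_jensenPoly_Fw_of_derivZerosReal {c ε : ℝ} (hc : 0 ≤ c) (hε : ε ≠ 0)
    (hD : (∀ w : ℂ, deriv (fun w : ℂ ↦ ((w + c) ^ 2 + (ε : ℂ) ^ 2) * coshSqrt w) w = 0 → w.im =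
        0)) {n : ℕ} (hn : 1 ≤ n) (d : ℕ) :
    (jensenPoly (taylorCoeffSeq ((fun w : ℂ ↦ ((w + c) ^ 2 + (ε : ℂ) ^ 2) * coshSqrt w))) d n).Splits := by
  obtain ⟨m, rfl⟩ := Nat.exists_eq_add_of_le' hn
  rw [jensenPoly_taylorCoeffSeq_succ]
  exact Literature.Analysis.Complex.PolyaSchur.splits_jensenPoly_taylor_of_zeros_real
    (isEntireOfOrderLtOne_deriv_Fw c ε) (by rw [deriv_Fw_zero, Complex.ofReal_im])
    (deriv_Fw_zero_ne hc hε) hD d m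

/-- All zeros of `F` lie in the sector `|Im w| ≤ δ ‖w‖` with `δ = ε / √(c² + ε²)` (equality at the pair).
[folklore] -/
theorem Fw_zero_mem_sector {c ε : ℝ} (hε : 0 < ε) {w : ℂ} (hw : ((w + c) ^ 2 + (ε : ℂ) ^ 2) * coshSqrt w = 0) :
    w ∈ sector (ε / Real.sqrt (c ^ 2 + ε ^ 2)) := by
  have hpos : 0 < Real.sqrt (c ^ 2 + ε ^ 2) := Real.sqrt_pos.2 (by positivity)
  rw [mem_sector]
  rcases (Fw_eq_zero_iff c ε w).1 hw with (rfl | rfl) | h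
  · rw [wPlus_im, norm_wPlus, div_mul_cancel₀ _ hpos.ne', abs_of_pos hε]
  · rw [wMinus_im, norm_wMinus, div_mul_cancel₀ _ hpos.ne', abs_neg, abs_of_pos hε]
  · rw [(im_eq_zero_of_coshSqrt_eq_zero h).1, abs_zero]
    positivity

/-- **FIN(D)-analogue (row 0).** `J^{d,0}(F)` is hyperbolic whenever `d · ε² ≤ c² + ε²`
(tree: Kim–Lee / Obreschkoff sector theorem for genus zero).
[cite: KimLee2021, Remark after Thm. 3] -/
theorem splits_jensenPoly_Fw_zero_of_le {c ε : ℝ} (hε : 0 < ε) {d : ℕ}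
    (hd : (d : ℝ) * ε ^ 2 ≤ c ^ 2 + ε ^ 2) :
    (jensenPoly (taylorCoeffSeq ((fun w : ℂ ↦ ((w + c) ^ 2 + (ε : ℂ) ^ 2) * coshSqrt w))) d 0).Splits := by
  have hpos : 0 < c ^ 2 + ε ^ 2 := by positivity
  have hδ : (d : ℝ) * (ε / Real.sqrt (c ^ 2 + ε ^ 2)) ^ 2 ≤ 1 := by
    rw [div_pow, Real.sq_sqrt hpos.le, ← mul_div_assoc, div_le_one hpos]
    exact hd
  show (jensenPoly (fun k ↦ (iteratedDeriv k ((fun w : ℂ ↦ ((w + c) ^ 2 + (ε : ℂ) ^ 2) * coshSqrt w)) 0).re) d 0).Splits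
  exact splits_jensenPoly_taylor_of_zeros_mem_sector (isEntireOfOrderLtOne_Fw c ε) (Fw_conj c ε)
    (Fw_zero_ne hε.ne') (fun z hz ↦ Fw_zero_mem_sector hε hz) hδ

/-- **FIN(D)-analogue, all rows.** Given the analytic input, every cell `(d, n)` with
`d · ε² ≤ c² + ε²` (any `n`) is hyperbolic. [cite: KimLee2021, Remark after Thm. 3] -/
theorem splits_jensenPoly_Fw_of_le {c ε : ℝ} (hc : 0 ≤
      c) (hε : 0 < ε) (hD : (∀ w : ℂ, deriv (fun w : ℂ ↦ ((w + c) ^ 2 + (ε : ℂ) ^ 2) * coshSqrt w) w =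
      0 → w.im = 0))
    {d : ℕ} (hd : (d : ℝ) * ε ^ 2 ≤ c ^ 2 + ε ^ 2) (n : ℕ) :
    (jensenPoly (taylorCoeffSeq ((fun w : ℂ ↦ ((w + c) ^ 2 + (ε : ℂ) ^ 2) * coshSqrt w))) d n).Splits := by
  rcases Nat.eq_zero_or_pos n with rfl | hn
  · exact splits_jensenPoly_Fw_zero_of_le hε hd
  · exact splits_jensenPoly_Fw_of_derivZerosReal hc hε.ne' hD hn d

/-! ### Pólya–Schur converse in the `taylorCoeffSeq` vocabulary (general bookkeeping wrapper) -/

/-- For an entire `F`, real on the real axis (`F(z̄) = conj F(z)`), with `F 0 ≠ 0`: if every row-`0`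
Jensen polynomial `J^{d,0}(F)` is hyperbolic then every zero of `F` is real. This is the tree's
`PolyaSchur.im_eq_zero_of_forall_splits_jensenPoly` (Hurwitz) with its power-series hypotheses discharged
by Taylor's theorem for entire functions and Cauchy's estimate (so it applies to ANY entire real `F`).
[cite: Polya1927] -/
theorem im_eq_zero_of_forall_splits_taylorCoeffSeq {F : ℂ → ℂ} (hFd : Differentiable ℂ F)
    (hreal : ∀ z, F (conj z) = conj (F z)) (h0 : F 0 ≠ 0)
    (hs : ∀ d : ℕ, (jensenPoly (taylorCoeffSeq F) d 0).Splits) {w : ℂ} (hw : F w = 0) :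
    w.im = 0 := by
  -- the Taylor coefficients at `0` are real
  have hre : ∀ j, ((taylorCoeffSeq F j : ℝ) : ℂ) = iteratedDeriv j F 0 := fun j ↦ by
    rw [taylorCoeffSeq]
    have h := iteratedDeriv_conj_of_conj hreal j 0
    rw [map_zero] at h
    exact Complex.conj_eq_iff_re.1 h.symm
  -- Taylor series of an entire function
  have hF : ∀ z : ℂ, HasSum (fun j ↦ ((taylorCoeffSeq F j : ℝ) : ℂ) / (j ! : ℂ) * z ^ j) (F z) := by
    intro z
    have h := Complex.hasSum_taylorSeries_of_entire hFd 0 z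
    simp only [sub_zero, smul_eq_mul] at h
    have e : (fun j ↦ ((taylorCoeffSeq F j : ℝ) : ℂ) / (j ! : ℂ) * z ^ j) =
        fun n ↦ (n ! : ℂ)⁻¹ * (z ^ n * iteratedDeriv n F 0) := by
      funext j
      rw [hre j, div_eq_mul_inv]
      ring
    rw [e]
    exact h
  -- absolute convergence from Cauchy's estimate on the circle of radius `2R + 1`
  have hsum : ∀ R : ℝ, 0 ≤ R → Summable fun j ↦ |taylorCoeffSeq F j| / (j ! : ℝ) * R ^ j := by
    intro R hR
    set ρ : ℝ := 2 * R + 1 with hρ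
    have hρ0 : 0 < ρ := by positivity
    obtain ⟨C, hC⟩ := (isCompact_sphere (0 : ℂ) ρ).exists_bound_of_continuousOn
      hFd.continuous.continuousOn
    have hq : R / ρ < 1 := by rw [div_lt_one hρ0]; linarith
    have hq0 : 0 ≤ R / ρ := div_nonneg hR hρ0.le
    have hC0 : 0 ≤ C := by
      have hz : ((ρ : ℝ) : ℂ) ∈ Metric.sphere (0 : ℂ) ρ := by
        simp [Complex.norm_real, Real.norm_eq_abs, abs_of_pos hρ0]
      exact (norm_nonneg _).trans (hC _ hz)
    refine Summable.of_nonneg_of_le (fun j ↦ by positivity) (fun j ↦ ?_)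
      ((summable_geometric_of_lt_one hq0 hq).mul_left C)
    have hcau := Complex.norm_iteratedDeriv_le_of_forall_mem_sphere_norm_le j hρ0 hFd.diffContOnCl hC
    have hγ : |taylorCoeffSeq F j| ≤ (j ! : ℝ) * C / ρ ^ j := (Complex.abs_re_le_norm _).trans hcau
    have hj : (0 : ℝ) < j ! := by exact_mod_cast Nat.factorial_pos j
    have hγ' : |taylorCoeffSeq F j| / (j ! : ℝ) ≤ C / ρ ^ j := by
      rw [div_le_iff₀ hj]
      calc |taylorCoeffSeq F j| ≤ (j ! : ℝ) * C / ρ ^ j := hγ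
        _ = C / ρ ^ j * (j ! : ℝ) := by ring
    calc |taylorCoeffSeq F j| / (j ! : ℝ) * R ^ j ≤ C / ρ ^ j * R ^ j := by gcongr
      _ = C * (R / ρ) ^ j := by rw [div_pow]; ring
  exact Literature.Analysis.Complex.PolyaSchur.im_eq_zero_of_forall_splits_jensenPoly hsum hF hFd h0
    hs hw

/-- **¬E_jen-analogue.** Some row-`0` Jensen polynomial of `F_{c,ε}` is NOT hyperbolic (`ε ≠ 0`):
otherwise the planted zero `-c + iε` would be real. [folklore] -/
theorem exists_not_splits_jensenPoly_Fw_zero {c ε : ℝ} (hε : ε ≠ 0) :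
    ∃ d : ℕ, ¬ (jensenPoly (taylorCoeffSeq ((fun w : ℂ ↦ ((w + c) ^ 2 + (ε : ℂ) ^ 2)
        * coshSqrt w))) d 0).Splits := by
  by_contra h
  push Not at h
  have him := im_eq_zero_of_forall_splits_taylorCoeffSeq (differentiable_Fw c ε) (Fw_conj c ε)
    (Fw_zero_ne hε) h (Fw_wPlus c ε)
  rw [wPlus_im] at him
  exact hε him

/-- `¬ AllHyperbolic` for the Taylor data of `F_{c,ε}` (`ε ≠ 0`). [folklore] -/
theorem not_allHyperbolic_Fw {c ε : ℝ} (hε : ε ≠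
      0) : ¬ AllHyperbolic (taylorCoeffSeq ((fun w : ℂ ↦ ((w + c) ^ 2 + (ε : ℂ) ^ 2) * coshSqrt w))) := by
  obtain ⟨d, hd⟩ := exists_not_splits_jensenPoly_Fw_zero (c := c) hε
  exact fun h ↦ hd (h d 0)

/-- LP*-analogue as a finiteness statement. [folklore] -/
theorem finite_nonreal_zeros_Fw {c ε : ℝ} (hε : ε ≠ 0) : {w : ℂ | ((w + c) ^ 2 + (ε : ℂ) ^ 2)
      * coshSqrt w = 0 ∧ w.im ≠ 0}.Finite := by
  refine (Set.toFinite {(-(c : ℂ) + ε * I), (-(c : ℂ) - ε * I)}).subset fun w hw ↦ ?_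
  rcases (Fw_eq_zero_im_ne_zero_iff hε w).1 hw with rfl | rfl <;> simp

/-! ## §4 The typed no-go shape (g0's V4 / §6(c) «WITNESS WANTED», now supplied) -/


/-- **The instance.** For `c = (kπ)²`, `k ≥ 1`, `0 < ε` with `D ε² ≤ c² + ε²`, and GIVEN the analytic input
`DerivZerosReal c ε`, the function `F_{c,ε}` is a `MixedSplitWitness c D`. [cite: Farmer2022, §4] -/
theorem mixedSplitWitness_Fw {k : ℕ} (hk : 1 ≤ k) {ε : ℝ} (hε : 0 < ε) {D : ℕ}
    (hD : (D : ℝ) * ε ^ 2 ≤ (((k : ℝ) * Real.pi) ^ 2) ^ 2 + ε ^ 2)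
    (hderiv : (∀ w : ℂ, deriv (fun w : ℂ ↦ ((w + ((((k : ℝ) * Real.pi) ^ 2 : ℝ) : ℂ)) ^ 2
        + (ε : ℂ) ^ 2) * coshSqrt w) w = 0 → w.im = 0)) :
    let F : ℂ → ℂ := fun w : ℂ ↦ ((w + ((((k : ℝ) * Real.pi) ^ 2 : ℝ) : ℂ)) ^ 2 + (ε : ℂ) ^ 2) * coshSqrt w
    (IsEntireOfOrderLtOne F ∧
      (∀ z, F (conj z) = conj (F z)) ∧ F 0 ≠ 0 ∧
      (∀ w : ℂ, F w = 0 → ‖w‖ ≤ ((k : ℝ) * Real.pi) ^ 2 → w.im = 0) ∧ (∃ w : ℂ, F w = 0 ∧ ‖w‖ ≤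
          ((k : ℝ) * Real.pi) ^ 2) ∧
      (∀ d n : ℕ, 1 ≤ n → (jensenPoly (taylorCoeffSeq F) d n).Splits) ∧
      (∀ d n : ℕ, d ≤ D → (jensenPoly (taylorCoeffSeq F) d n).Splits) ∧
      {w : ℂ | F w = 0 ∧ w.im ≠ 0}.Finite ∧
      EventuallyHyperbolic (taylorCoeffSeq F) ∧ ¬ AllHyperbolic (taylorCoeffSeq F)) := by
  intro F
  have hc0 : 0 ≤ ((k : ℝ) * Real.pi) ^ 2 := by positivity
  refine ⟨isEntireOfOrderLtOne_Fw _ ε, Fw_conj _ ε, Fw_zero_ne hε.ne', ?_, ?_, ?_, ?_, ?_, ?_, ?_⟩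
  · exact fun w hw hn ↦ (im_eq_zero_of_Fw_eq_zero_of_norm_le hc0 hε.ne' hw hn).1
  · exact ⟨_, Fw_seaZero _ ε 0, norm_seaZero_le hk⟩
  · exact fun d n hn ↦ splits_jensenPoly_Fw_of_derivZerosReal hc0 hε.ne' hderiv hn d
  · intro d n hd
    refine splits_jensenPoly_Fw_of_le hc0 hε hderiv ?_ n
    calc (d : ℝ) * ε ^ 2 ≤ D * ε ^ 2 := by gcongr
      _ ≤ (((k : ℝ) * Real.pi) ^ 2) ^ 2 + ε ^ 2 := hD
  · exact finite_nonreal_zeros_Fw hε.ne'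
  · exact fun d _ ↦ ⟨1, fun n hn ↦ splits_jensenPoly_Fw_of_derivZerosReal hc0 hε.ne' hderiv hn d⟩
  · exact not_allHyperbolic_Fw hε.ne'

/-- **For every threshold pair `(C, D)` there is a witness** (given the analytic input for the family
`c = (kπ)²`, `k ≥ 1`, `0 < ε ≤ 1`): take `k = ⌈C⌉ + 1`, `ε = 1/(D+1)`. [cite: Farmer2022, §4] -/
theorem exists_mixedSplitWitness (C : ℝ) (D : ℕ)
    (hderiv : ∀ (k : ℕ) (ε : ℝ), 1 ≤ k → 0 < ε → ε ≤ 1 → (∀ w : ℂ, deriv (fun w : ℂ ↦ ((w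
        + ((((k : ℝ) * Real.pi) ^ 2 : ℝ) : ℂ)) ^ 2 + (ε : ℂ) ^ 2) * coshSqrt w) w = 0 → w.im = 0)) :
    ∃ (c : ℝ) (F : ℂ → ℂ), C ≤ c ∧
      (IsEntireOfOrderLtOne F ∧
      (∀ z, F (conj z) = conj (F z)) ∧ F 0 ≠ 0 ∧
      (∀ w : ℂ, F w = 0 → ‖w‖ ≤ c → w.im = 0) ∧ (∃ w : ℂ, F w = 0 ∧ ‖w‖ ≤ c) ∧
      (∀ d n : ℕ, 1 ≤ n → (jensenPoly (taylorCoeffSeq F) d n).Splits) ∧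
      (∀ d n : ℕ, d ≤ D → (jensenPoly (taylorCoeffSeq F) d n).Splits) ∧
      {w : ℂ | F w = 0 ∧ w.im ≠ 0}.Finite ∧
      EventuallyHyperbolic (taylorCoeffSeq F) ∧ ¬ AllHyperbolic (taylorCoeffSeq F)) := by
  set k : ℕ := ⌈C⌉₊ + 1 with hk
  have hk1 : 1 ≤ k := by omega
  set ε : ℝ := 1 / ((D : ℝ) + 1) with hε
  have hD0 : (0 : ℝ) ≤ D := Nat.cast_nonneg D
  have hε0 : 0 < ε := by positivity
  have hDε1 : (D : ℝ) * ε ≤ 1 := by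
    rw [hε, ← mul_div_assoc, mul_one, div_le_one (by positivity)]; linarith
  have hε1 : ε ≤ 1 := by
    rw [hε, div_le_one (by positivity)]; linarith
  have hk' : (1 : ℝ) ≤ k := by exact_mod_cast hk1
  have hπ : (3 : ℝ) < Real.pi := Real.pi_gt_three
  have hkπ : (1 : ℝ) ≤ (k : ℝ) * Real.pi := by nlinarith
  have hc1 : (1 : ℝ) ≤ ((k : ℝ) * Real.pi) ^ 2 := by nlinarith
  refine ⟨((k : ℝ) * Real.pi) ^ 2, (fun w : ℂ ↦ ((w + ((((k : ℝ) * Real.pi) ^ 2 : ℝ) : ℂ)) ^ 2 + (ε : ℂ) ^ 2) * coshSqrt w), ?_,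
    mixedSplitWitness_Fw hk1 hε0 ?_ (hderiv k ε hk1 hε0 hε1)⟩
  · have h1 : C ≤ k := by
      have h2 := Nat.le_ceil C
      have h3 : ((⌈C⌉₊ : ℕ) : ℝ) + 1 = ((k : ℕ) : ℝ) := by rw [hk]; push_cast; ring
      linarith
    have hkk : (k : ℝ) ≤ (k : ℝ) * k := le_mul_of_one_le_left (by positivity) hk'
    have hππ : (1 : ℝ) ≤ Real.pi * Real.pi := by nlinarith
    calc C ≤ k := h1
      _ ≤ k * k := hkk
      _ ≤ k * k * (Real.pi * Real.pi) := le_mul_of_one_le_right (by positivity) hππ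
      _ = ((k : ℝ) * Real.pi) ^ 2 := by ring
  · have hDε : (D : ℝ) * ε ^ 2 ≤ 1 := by nlinarith
    have hc2 : (1 : ℝ) ≤ (((k : ℝ) * Real.pi) ^ 2) ^ 2 := by nlinarith
    nlinarith [sq_nonneg ε]

/-! ## §5a `F`-free identities and inequalities for part 3 -/

/-- `sinh u · conj (cosh u) = (sinh (2 Re u) + i sin (2 Im u)) / 2`. [folklore] -/
theorem sinh_mul_conj_cosh (u : ℂ) :
    Complex.sinh u * conj (Complex.cosh u) =
      ((Real.sinh (2 * u.re) / 2 : ℝ) : ℂ) + ((Real.sin (2 * u.im) / 2 : ℝ) : ℂ) * I := by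
  have e1 : Complex.sinh u * conj (Complex.cosh u) =
      (Complex.sinh (u + conj u) + Complex.sinh (u - conj u)) / 2 := by
    rw [← Complex.cosh_conj, Complex.sinh_add, Complex.sinh_sub]; ring
  rw [e1, Complex.add_conj, Complex.sub_conj, ← Complex.ofReal_sinh, Complex.sinh_mul_I,
    ← Complex.ofReal_sin]
  push_cast
  ring

/-- `Im (sinh u · conj (cosh u) · conj u) = (Re u · sin (2 Im u) − Im u · sinh (2 Re u)) / 2`.
[folklore] -/
theorem im_sinh_mul_conj_cosh_mul_conj (u : ℂ) :
    (Complex.sinh u * conj (Complex.cosh u) * conj u).im =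
      (u.re * Real.sin (2 * u.im) - u.im * Real.sinh (2 * u.re)) / 2 := by
  rw [sinh_mul_conj_cosh]
  simp only [Complex.mul_im, Complex.add_re, Complex.add_im, Complex.ofReal_re, Complex.ofReal_im,
    Complex.mul_re, Complex.I_re, Complex.I_im, Complex.conj_re, Complex.conj_im]
  ring

/-- `t · sin t < t²` for `t ≠ 0`. [folklore] -/
theorem mul_sin_lt_sq {t : ℝ} (ht : t ≠ 0) : t * Real.sin t < t ^ 2 := by
  rcases lt_or_gt_of_ne ht with h | h
  · have h1 := Real.sin_lt (neg_pos.2 h)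
    rw [Real.sin_neg] at h1
    nlinarith
  · have h1 := Real.sin_lt h
    nlinarith

/-- `t² < t · sinh t` for `t ≠ 0`. [folklore] -/
theorem sq_lt_mul_sinh {t : ℝ} (ht : t ≠ 0) : t ^ 2 < t * Real.sinh t := by
  rcases lt_or_gt_of_ne ht with h | h
  · have h1 := Real.sinh_lt_self_iff.2 h
    nlinarith
  · have h1 := Real.self_lt_sinh_iff.2 h
    nlinarith

/-- The sign that drives the outside-the-disc case: `ab (a sin 2b − b sinh 2a) < 0` for `a, b ≠ 0`.
[folklore] -/
theorem mul_mul_sub_neg {a b : ℝ} (ha : a ≠ 0) (hb : b ≠ 0) :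
    a * b * (a * Real.sin (2 * b) - b * Real.sinh (2 * a)) < 0 := by
  have h1 := mul_sin_lt_sq (mul_ne_zero two_ne_zero hb)
  have h2 := sq_lt_mul_sinh (mul_ne_zero two_ne_zero ha)
  have haa : 0 < a * a := mul_self_pos.2 ha
  have hbb : 0 < b * b := mul_self_pos.2 hb
  nlinarith [mul_lt_mul_of_pos_left h1 haa, mul_lt_mul_of_pos_left h2 hbb]

/-- `Im (z · conj (z² + ε²)) = Im z · (ε² − ‖z‖²)`. [folklore] -/
theorem im_mul_conj_sq_add (z : ℂ) (ε : ℝ) :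
    (z * conj (z ^ 2 + (ε : ℂ) ^ 2)).im = z.im * (ε ^ 2 - Complex.normSq z) := by
  simp only [map_add, Complex.mul_im, Complex.add_re, Complex.add_im, sq, Complex.mul_re,
    Complex.conj_re, Complex.conj_im, Complex.ofReal_re, Complex.ofReal_im, Complex.normSq_apply]
  ring

end Summit.RiemannHypothesis.RiemannHypothesis.Theorems.Splittings.JensenMixedSplit

end
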